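import Mathlib
import HarnessLib

/-!
# THE QUADRATIC PARTITION OF UNITY (2.36), I: a C²-flat profile `Θ` on `ℝ` with `Σ_k Θ(t − k)² = 1` EXACTLY (two neighbours, `cos² + sin²`), `|Θ| ≤ 1`, the Lipschitz letter
# `|Θ(s) − Θ(t)| ≤ π|s − t|` and the second-difference letter `|Θ(t+η) − 2Θ(t) + Θ(t−η)| ≤ 12π²η²` — the two smoothness constants `c₁ = O(M⁻¹)`, `c₂ = O(M⁻²)` every gluing file of this
# lineage (FILES 45–58) displays for `h_□(x) = Θ(x∕M − k)` — by ELEMENTARY trigonometric inequalities, no calculus (dag-n15-c g11, FILE 59; N15 = NE2, s1 «background-layer OPERATOR ingredient»)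

Cell `pub-ymgap`, seat `pub-ymgap-dag-n15-c` (R134 (a); HUMAN RULING D-0062), generation 11.  `bears_on: R4∕N15 · K3⁷ SpineGivenEndpointR13SepCoPH (stmt-QuantumFields-20544)`.
Filed `--supports stmt-QuantumFields-20544 --as helper` — COUNT-NEUTRAL.  Two plumbing `def`s (`phiP`, `thetaP`; review-queued, D-0009), the rest theorems; 0 `sorry`.  Imports `Mathlib` only
(`Real.abs_sin_sub_sin_le`, `Real.abs_cos_sub_cos_le`, `Real.one_sub_sq_div_two_le_cos`, `Real.sin_gt_sub_cube`, `Real.sin_le`, `Real.cos_add_cos`).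

WHY.  [B6] (2.36) p.229: «a partition of unity `Σ_□ h_□² = 1`, `h_□ ∈ C₀^∞`, `h_□ = 1` well inside `□`, `|∂^α h_□| ≤ O(1)M^{−|α|}`» — the gluing's every remainder letter is O(M⁻¹) THROUGH these
derivative bounds (FILE 46 `c₁, c₂`; FILE 56 `ℓ, ω`).  No seat had typed the partition.  THIS FILE gives the one-dimensional PROFILE (the `d`-dimensional partition is the product over
coordinates, the lattice one its sampling at `t = x∕(Mn) − k`): `φ(t) = t − sin(2πt)∕(2π)` (monotone, `φ(t − 1) = φ(t) − 1`, odd, `|φ(s) − φ(t)| ≤ 2|s − t|`, `φ(u) ≤ 4πu²` for `u ≥ 0`,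
second difference `≤ 2πη²`) and `Θ(t) = cos((π∕2)φ(t))·1_{|t| ≤ 1}`: ★★ `thetaP_sq_add_sq` — `Θ(s)² + Θ(s − 1)² = 1` on `0 ≤ s ≤ 1` (`cos² + sin²`: `(π∕2)φ(s − 1) = (π∕2)φ(s) − π∕2`); ★
`thetaP_eq_zero_of_one_le_abs`, `thetaP_sub_int_ne_zero` (only `k ∈ {⌊t⌋, ⌊t⌋ + 1}` contribute) and ★★ `thetaP_partition` — `Θ(t − ⌊t⌋)² + Θ(t − ⌊t⌋ − 1)² = 1` for every real `t`; ★★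
`abs_thetaP_sub_le` — `|Θ(s) − Θ(t)| ≤ π|s − t|` (cos is 1-Lipschitz, `φ` is 2-Lipschitz, `Θ(±1) = 0`); ★ `thetaP_one_sub_le` — flatness at the ends `0 ≤ Θ(1 − u) ≤ 2π²u²`
(`Θ(1 − u) = sin((π∕2)φ(u))`, `z − sin z ≤ 2z²`); ★★★ `abs_thetaP_second_diff_le` — `|Θ(t+η) − 2Θ(t) + Θ(t−η)| ≤ 12π²η²` for `0 ≤ η ≤ 1` (interior: `cos b₊ − 2cos a + cos b₋ =
(cos b₊ − cos(2a − b₋)) + 2cos a(cos(a − b₋) − 1)`, each `≤ π²η²`; near `±1`: the flatness).  So `h_k(x) := Θ(x∕(Mn) − k)` has `|∇h| ≤ π∕M`, `|∇*∇h| ≤ 12π²∕M²`, `Σ_k h_k² = 1`,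
`N_ov = 2` per coordinate — the letters `c₁, c₂` of FILES 46∕52∕53 and `ℓ, ω` of FILE 56 with explicit constants.

HONEST FRAMING ∕ LIMITS.  Elementary real analysis; [B6] (2.36) p.229 = the printed requirement (shape); the profile is this file's choice (print: «e.g.» any smooth partition); the
`d`-dimensional ∕ toroidal sampling is NOT in this file (sequel).  Nothing of [B6]∕[B9] asserted.  NE2⁺ NOT PRINTED, NOT proved; N15 NOT discharged; counts of record UNMOVED (typed
28∕28 · discharged 5∕27); one finite 𝕋⁴ at fixed ε — NOT infinite volume, NOT OS on ℝ⁴, NOT a mass gap, NOT Clay; R4 closes the conditional finite-𝕋⁴ rung `BalabanLadder.UV` only.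
-/

noncomputable section

namespace Summit.QuantumFields.YangMills.BalabanUVNodes.N15.Gluing

open Real

/-! ## §1 The phase `φ(t) = t − sin(2πt)∕(2π)` -/

/-- The phase reparametrisation `φ(t) = t − sin(2πt)∕(2π)` — increasing, `φ(k) = k`, flat to second order at the integers. [cite: Balaban1984PropagatorsII, (2.36) p.229 (the partition's smoothness requirement: shape)] -/
def phiP (t : ℝ) : ℝ := t - Real.sin (2 * π * t) / (2 * π)

/-- The profile `Θ(t) = cos((π∕2)φ(t))` on `|t| ≤ 1`, `0` outside. [cite: Balaban1984PropagatorsII, (2.36) p.229 (shape)] -/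
def thetaP (t : ℝ) : ℝ := if |t| ≤ 1 then Real.cos (π / 2 * phiP t) else 0

/-- `φ(t − 1) = φ(t) − 1`. [folklore] -/
theorem phiP_sub_one (t : ℝ) : phiP (t - 1) = phiP t - 1 := by
  unfold phiP
  rw [show 2 * π * (t - 1) = 2 * π * t - 2 * π by ring, Real.sin_sub_two_pi]
  ring

/-- `φ` is odd. [folklore] -/
theorem phiP_neg (t : ℝ) : phiP (-t) = -phiP t := by
  unfold phiP
  rw [show 2 * π * -t = -(2 * π * t) by ring, Real.sin_neg]
  ring

/-- `φ(0) = 0`. [folklore] -/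
theorem phiP_zero : phiP 0 = 0 := by simp [phiP]

/-- `φ(1) = 1`. [folklore] -/
theorem phiP_one : phiP 1 = 1 := by
  unfold phiP
  rw [mul_one, Real.sin_two_pi]
  ring

/-- `φ` is 2-Lipschitz. [folklore] -/
theorem abs_phiP_sub_le (s t : ℝ) : |phiP s - phiP t| ≤ 2 * |s - t| := by
  unfold phiP
  have hπ : 0 < 2 * π := by positivity
  have h1 := Real.abs_sin_sub_sin_le (2 * π * s) (2 * π * t)
  rw [show 2 * π * s - 2 * π * t = 2 * π * (s - t) by ring, abs_mul, abs_of_pos hπ] at h1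
  have h2 : |(Real.sin (2 * π * s) - Real.sin (2 * π * t)) / (2 * π)| ≤ |s - t| := by
    rw [abs_div, abs_of_pos hπ, div_le_iff₀ hπ]
    linarith
  calc |s - Real.sin (2 * π * s) / (2 * π) - (t - Real.sin (2 * π * t) / (2 * π))|
      = |(s - t) - (Real.sin (2 * π * s) - Real.sin (2 * π * t)) / (2 * π)| := by ring_nf
    _ ≤ |s - t| + |(Real.sin (2 * π * s) - Real.sin (2 * π * t)) / (2 * π)| := abs_sub _ _
    _ ≤ 2 * |s - t| := by linarith

/-- `φ` is monotone (no calculus: `|sin a − sin b| ≤ |a − b|`). [folklore] -/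
theorem phiP_mono {s t : ℝ} (h : t ≤ s) : phiP t ≤ phiP s := by
  unfold phiP
  have hπ : 0 < 2 * π := by positivity
  have h1 := Real.abs_sin_sub_sin_le (2 * π * s) (2 * π * t)
  rw [show 2 * π * s - 2 * π * t = 2 * π * (s - t) by ring, abs_mul, abs_of_pos hπ, abs_of_nonneg (sub_nonneg.2 h)] at h1
  have h2 : Real.sin (2 * π * s) - Real.sin (2 * π * t) ≤ 2 * π * (s - t) := (le_abs_self _).trans h1
  have h3 : (Real.sin (2 * π * s) - Real.sin (2 * π * t)) / (2 * π) ≤ s - t := by rw [div_le_iff₀ hπ]; linarith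
  have h4 : Real.sin (2 * π * s) / (2 * π) - Real.sin (2 * π * t) / (2 * π) ≤ s - t := by rw [← sub_div]; exact h3
  linarith

/-- `|φ| ≤ 1` on `[−1, 1]`. [folklore] -/
theorem abs_phiP_le_one {t : ℝ} (ht : |t| ≤ 1) : |phiP t| ≤ 1 := by
  rw [abs_le] at ht ⊢
  constructor
  · have := phiP_mono ht.1; rw [show (-1 : ℝ) = -(1 : ℝ) from rfl, phiP_neg, phiP_one] at this; exact this
  · have := phiP_mono ht.2; rw [phiP_one] at this; exact this

/-- `z − sin z ≤ 2z²` for `z ≥ 0`. [folklore] -/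
theorem sub_sin_le_two_sq {z : ℝ} (hz : 0 ≤ z) : z - Real.sin z ≤ 2 * z ^ 2 := by
  rcases eq_or_lt_of_le hz with h | h
  · rw [← h]; simp
  by_cases h1 : z ≤ 1
  · have := Real.sin_gt_sub_cube h
    nlinarith [pow_nonneg hz 3, pow_le_pow_left₀ hz h1 3]
  · push Not at h1
    nlinarith [Real.neg_one_le_sin z]

/-- Flatness of `φ` at `0`: `0 ≤ φ(u) ≤ 4πu²` for `u ≥ 0`. [folklore] -/
theorem phiP_le_sq {u : ℝ} (hu : 0 ≤ u) : 0 ≤ phiP u ∧ phiP u ≤ 4 * π * u ^ 2 := by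
  unfold phiP
  have hπ : 0 < 2 * π := by positivity
  have hz : 0 ≤ 2 * π * u := by positivity
  constructor
  · have := Real.sin_le hz
    rw [sub_nonneg, div_le_iff₀ hπ]; linarith
  · have := sub_sin_le_two_sq hz
    have key : u - Real.sin (2 * π * u) / (2 * π) = (2 * π * u - Real.sin (2 * π * u)) / (2 * π) := by field_simp
    rw [key, div_le_iff₀ hπ]
    nlinarith [Real.pi_pos]

/-- The second difference of `φ`: `|φ(t+η) − 2φ(t) + φ(t−η)| ≤ 2πη²`. [folklore] -/
theorem abs_phiP_second_diff_le (t η : ℝ) : |phiP (t + η) - 2 * phiP t + phiP (t - η)| ≤ 2 * π * η ^ 2 := by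
  unfold phiP
  have hπ : 0 < 2 * π := by positivity
  have hsum : Real.sin (2 * π * (t + η)) + Real.sin (2 * π * (t - η)) = 2 * Real.sin (2 * π * t) * Real.cos (2 * π * η) := by
    rw [show 2 * π * (t + η) = 2 * π * t + 2 * π * η by ring, show 2 * π * (t - η) = 2 * π * t - 2 * π * η by ring, Real.sin_add, Real.sin_sub]
    ring
  have e : ∀ A B C D : ℝ, A + B = 2 * C * D →
      t + η - A / (2 * π) - 2 * (t - C / (2 * π)) + (t - η - B / (2 * π)) = C * (1 - D) / π := by
    intro A B C D h
    obtain rfl : A = 2 * C * D - B := by linarith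
    field_simp
    ring
  have key : t + η - Real.sin (2 * π * (t + η)) / (2 * π) - 2 * (t - Real.sin (2 * π * t) / (2 * π)) + (t - η - Real.sin (2 * π * (t - η)) / (2 * π)) =
      Real.sin (2 * π * t) * (1 - Real.cos (2 * π * η)) / π := e _ _ _ _ hsum
  rw [key, abs_div, abs_of_pos Real.pi_pos, div_le_iff₀ Real.pi_pos, abs_mul]
  have h1 : |Real.sin (2 * π * t)| ≤ 1 := Real.abs_sin_le_one _
  have h2 : 0 ≤ 1 - Real.cos (2 * π * η) := by linarith [Real.cos_le_one (2 * π * η)]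
  have h3 : 1 - Real.cos (2 * π * η) ≤ (2 * π * η) ^ 2 / 2 := by linarith [Real.one_sub_sq_div_two_le_cos (x := 2 * π * η)]
  rw [abs_of_nonneg h2]
  calc |Real.sin (2 * π * t)| * (1 - Real.cos (2 * π * η)) ≤ 1 * ((2 * π * η) ^ 2 / 2) := mul_le_mul h1 h3 h2 zero_le_one
    _ = 2 * π * η ^ 2 * π := by ring

/-! ## §2 The profile `Θ`: size, support, the exact quadratic partition -/

/-- `Θ` is even. [folklore] -/
theorem thetaP_neg (t : ℝ) : thetaP (-t) = thetaP t := by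
  unfold thetaP
  rw [abs_neg, phiP_neg, mul_neg, Real.cos_neg]

/-- `|Θ| ≤ 1`. [folklore] -/
theorem abs_thetaP_le_one (t : ℝ) : |thetaP t| ≤ 1 := by
  unfold thetaP
  split_ifs
  · exact Real.abs_cos_le_one _
  · simp

/-- `Θ ≥ 0`. [folklore] -/
theorem thetaP_nonneg (t : ℝ) : 0 ≤ thetaP t := by
  unfold thetaP
  split_ifs with h
  · have hφ := abs_le.1 (abs_phiP_le_one h)
    exact Real.cos_nonneg_of_neg_pi_div_two_le_of_le (by nlinarith [Real.pi_pos]) (by nlinarith [Real.pi_pos])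
  · exact le_rfl

/-- The formula inside `[−1, 1]`. [folklore] -/
theorem thetaP_of_abs_le {t : ℝ} (ht : |t| ≤ 1) : thetaP t = Real.cos (π / 2 * phiP t) := by
  unfold thetaP; rw [if_pos ht]

/-- ★ `Θ(t) = 0` for `|t| ≥ 1` (at `|t| = 1`: `cos(±π∕2) = 0`). [folklore] -/
theorem thetaP_eq_zero_of_one_le_abs {t : ℝ} (ht : 1 ≤ |t|) : thetaP t = 0 := by
  unfold thetaP
  split_ifs with h
  · have h1 : |t| = 1 := le_antisymm h ht
    rcases (abs_eq zero_le_one).1 h1 with rfl | rfl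
    · rw [phiP_one, mul_one, Real.cos_pi_div_two]
    · rw [phiP_neg, phiP_one, mul_neg, mul_one, Real.cos_neg, Real.cos_pi_div_two]
  · rfl

/-- ★★ **THE EXACT QUADRATIC PARTITION, two neighbours**: `Θ(s)² + Θ(s − 1)² = 1` for `0 ≤ s ≤ 1` (`cos² + sin²`, since `(π∕2)φ(s − 1) = (π∕2)φ(s) − π∕2`). [cite: Balaban1984PropagatorsII, (2.36) p.229] -/
theorem thetaP_sq_add_sq {s : ℝ} (h0 : 0 ≤ s) (h1 : s ≤ 1) : thetaP s ^ 2 + thetaP (s - 1) ^ 2 = 1 := by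
  have hs : |s| ≤ 1 := abs_le.2 ⟨by linarith, h1⟩
  have hs1 : |s - 1| ≤ 1 := abs_le.2 ⟨by linarith, by linarith⟩
  rw [thetaP_of_abs_le hs, thetaP_of_abs_le hs1, phiP_sub_one, show π / 2 * (phiP s - 1) = π / 2 * phiP s - π / 2 by ring, Real.cos_sub_pi_div_two,
    Real.cos_sq_add_sin_sq]

/-- ★ Only the two neighbours contribute: `Θ(t − k) ≠ 0` forces `k ∈ {⌊t⌋, ⌊t⌋ + 1}`. [folklore] -/
theorem thetaP_sub_int_ne_zero {t : ℝ} {k : ℤ} (h : thetaP (t - k) ≠ 0) : k = ⌊t⌋ ∨ k = ⌊t⌋ + 1 := by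
  have hlt : |t - k| < 1 := by
    by_contra hc
    exact h (thetaP_eq_zero_of_one_le_abs (not_lt.1 hc))
  rw [abs_lt] at hlt
  have h1 := Int.floor_le t
  have h2 := Int.lt_floor_add_one t
  have hk1 : ⌊t⌋ ≤ k := by
    by_contra hc
    have hc' : k + 1 ≤ ⌊t⌋ := by omega
    have : (k : ℝ) + 1 ≤ (⌊t⌋ : ℝ) := by exact_mod_cast hc'
    linarith
  have hk2 : k ≤ ⌊t⌋ + 1 := by
    by_contra hc
    have hc' : ⌊t⌋ + 2 ≤ k := by omega
    have : (⌊t⌋ : ℝ) + 2 ≤ (k : ℝ) := by exact_mod_cast hc'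
    linarith
  omega

/-- ★★ **THE PARTITION AT EVERY REAL POINT**: `Θ(t − ⌊t⌋)² + Θ(t − ⌊t⌋ − 1)² = 1`. [cite: Balaban1984PropagatorsII, (2.36) p.229] -/
theorem thetaP_partition (t : ℝ) : thetaP (t - ⌊t⌋) ^ 2 + thetaP (t - ⌊t⌋ - 1) ^ 2 = 1 :=
  thetaP_sq_add_sq (sub_nonneg.2 (Int.floor_le t)) (by linarith [Int.lt_floor_add_one t])

/-! ## §3 The two smoothness letters -/

/-- ★★ **THE LIPSCHITZ LETTER** `|Θ(s) − Θ(t)| ≤ π|s − t|` (⟹ `|∇h_□| ≤ π∕M` for `h_□(x) = Θ(x∕(Mn) − k)`). [cite: Balaban1984PropagatorsII, (2.36) p.229 («|∂h_□| ≤ O(1)M⁻¹»: shape)] -/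
theorem abs_thetaP_sub_le (s t : ℝ) : |thetaP s - thetaP t| ≤ π * |s - t| := by
  -- both inside
  have hin : ∀ s t : ℝ, |s| ≤ 1 → |t| ≤ 1 → |thetaP s - thetaP t| ≤ π * |s - t| := by
    intro s t hs ht
    rw [thetaP_of_abs_le hs, thetaP_of_abs_le ht]
    refine (Real.abs_cos_sub_cos_le _ _).trans ?_
    rw [← mul_sub, abs_mul, abs_of_pos (by positivity : (0 : ℝ) < π / 2)]
    have := abs_phiP_sub_le s t
    nlinarith [Real.pi_pos, abs_nonneg (s - t)]
  -- one inside, one outside: compare with the endpoint between them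
  have hmix : ∀ s t : ℝ, |s| ≤ 1 → 1 < |t| → |thetaP s - thetaP t| ≤ π * |s - t| := by
    intro s t hs ht
    rw [thetaP_eq_zero_of_one_le_abs ht.le, sub_zero]
    have hs' := abs_le.1 hs
    by_cases hpos : 0 ≤ t
    · have ht1 : 1 < t := by rwa [abs_of_nonneg hpos] at ht
      have e1 : thetaP 1 = 0 := thetaP_eq_zero_of_one_le_abs (by rw [abs_one])
      have key := hin s 1 hs (by rw [abs_one])
      rw [e1, sub_zero] at key
      refine key.trans (mul_le_mul_of_nonneg_left ?_ Real.pi_pos.le)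
      rw [abs_of_nonpos (by linarith : s - 1 ≤ 0), abs_of_nonpos (by linarith : s - t ≤ 0)]; linarith
    · push Not at hpos
      have ht1 : t < -1 := by rw [abs_of_neg hpos] at ht; linarith
      have e1 : thetaP (-1) = 0 := thetaP_eq_zero_of_one_le_abs (by rw [abs_neg, abs_one])
      have key := hin s (-1) hs (by rw [abs_neg, abs_one])
      rw [e1, sub_zero] at key
      refine key.trans (mul_le_mul_of_nonneg_left ?_ Real.pi_pos.le)
      rw [abs_of_nonneg (by linarith : 0 ≤ s - -1), abs_of_nonneg (by linarith : 0 ≤ s - t)]; linarith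
  by_cases hs : |s| ≤ 1
  · by_cases ht : |t| ≤ 1
    · exact hin s t hs ht
    · exact hmix s t hs (not_le.1 ht)
  · by_cases ht : |t| ≤ 1
    · rw [abs_sub_comm, abs_sub_comm s t]; exact hmix t s ht (not_le.1 hs)
    · rw [thetaP_eq_zero_of_one_le_abs (not_le.1 hs).le, thetaP_eq_zero_of_one_le_abs (not_le.1 ht).le, sub_zero, abs_zero]
      positivity

/-- ★ **FLATNESS AT THE ENDS**: `Θ(1 − u) = sin((π∕2)φ(u)) ≤ 2π²u²` for `0 ≤ u ≤ 2`. [folklore] -/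
theorem thetaP_one_sub_le {u : ℝ} (h0 : 0 ≤ u) (h2 : u ≤ 2) : thetaP (1 - u) ≤ 2 * π ^ 2 * u ^ 2 := by
  have hu : |1 - u| ≤ 1 := abs_le.2 ⟨by linarith, by linarith⟩
  have hφ : phiP (1 - u) = 1 - phiP u := by
    have := phiP_sub_one (1 - u + 1)  -- φ(1 − u) = φ(2 − u) − 1: not needed; use oddness instead
    rw [show (1 : ℝ) - u = -(u - 1) by ring, phiP_neg, phiP_sub_one]; ring
  rw [thetaP_of_abs_le hu, hφ, show π / 2 * (1 - phiP u) = π / 2 - π / 2 * phiP u by ring, Real.cos_pi_div_two_sub]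
  obtain ⟨hφ0, hφ2⟩ := phiP_le_sq h0
  calc Real.sin (π / 2 * phiP u) ≤ π / 2 * phiP u := Real.sin_le (by positivity)
    _ ≤ π / 2 * (4 * π * u ^ 2) := mul_le_mul_of_nonneg_left hφ2 (by positivity)
    _ = 2 * π ^ 2 * u ^ 2 := by ring

/-- The interior second difference: all three points in `[−1, 1]` ⟹ `≤ 2π²η²`. [folklore] -/
theorem abs_thetaP_second_diff_le_of_abs_le {t η : ℝ} (hp : |t + η| ≤ 1) (h0 : |t| ≤ 1) (hm : |t - η| ≤ 1) :
    |thetaP (t + η) - 2 * thetaP t + thetaP (t - η)| ≤ 2 * π ^ 2 * η ^ 2 := by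
  rw [thetaP_of_abs_le hp, thetaP_of_abs_le h0, thetaP_of_abs_le hm]
  set a := π / 2 * phiP t with ha
  set bp := π / 2 * phiP (t + η) with hbp
  set bm := π / 2 * phiP (t - η) with hbm
  -- cos bp − 2cos a + cos bm = (cos bp − cos (2a − bm)) + 2 cos a (cos (a − bm) − 1)
  have hdec : Real.cos bp - 2 * Real.cos a + Real.cos bm = (Real.cos bp - Real.cos (2 * a - bm)) + 2 * Real.cos a * (Real.cos (a - bm) - 1) := by
    have := Real.cos_add_cos (2 * a - bm) bm
    rw [show (2 * a - bm + bm) / 2 = a by ring, show (2 * a - bm - bm) / 2 = a - bm by ring] at this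
    linarith
  rw [hdec]
  have hπ2 : (0 : ℝ) < π / 2 := by positivity
  -- first piece: the second difference of φ
  have h1 : |Real.cos bp - Real.cos (2 * a - bm)| ≤ π ^ 2 * η ^ 2 := by
    refine (Real.abs_cos_sub_cos_le _ _).trans ?_
    have e : bp - (2 * a - bm) = π / 2 * (phiP (t + η) - 2 * phiP t + phiP (t - η)) := by rw [hbp, ha, hbm]; ring
    rw [e, abs_mul, abs_of_pos hπ2]
    have := abs_phiP_second_diff_le t η
    nlinarith [Real.pi_pos]
  -- second piece: 1 − cos(a − bm) ≤ (a − bm)²/2 ≤ (πη)²/2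
  have h2 : |2 * Real.cos a * (Real.cos (a - bm) - 1)| ≤ π ^ 2 * η ^ 2 := by
    have hd : |a - bm| ≤ π * |η| := by
      have e : a - bm = π / 2 * (phiP t - phiP (t - η)) := by rw [ha, hbm]; ring
      rw [e, abs_mul, abs_of_pos hπ2]
      have := abs_phiP_sub_le t (t - η)
      rw [show t - (t - η) = η by ring] at this
      nlinarith [Real.pi_pos, abs_nonneg η]
    have hc : 0 ≤ 1 - Real.cos (a - bm) := by linarith [Real.cos_le_one (a - bm)]
    have hc2 : 1 - Real.cos (a - bm) ≤ (a - bm) ^ 2 / 2 := by linarith [Real.one_sub_sq_div_two_le_cos (x := a - bm)]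
    have hsq : (a - bm) ^ 2 ≤ (π * |η|) ^ 2 := by
      have := sq_abs (a - bm); rw [← this]; exact pow_le_pow_left₀ (abs_nonneg _) hd 2
    rw [abs_mul, abs_mul, abs_two, show |Real.cos (a - bm) - 1| = 1 - Real.cos (a - bm) by rw [abs_sub_comm]; exact abs_of_nonneg hc]
    have hca : |Real.cos a| ≤ 1 := Real.abs_cos_le_one _
    calc 2 * |Real.cos a| * (1 - Real.cos (a - bm)) ≤ 2 * 1 * ((π * |η|) ^ 2 / 2) := by
          refine mul_le_mul (mul_le_mul_of_nonneg_left hca zero_le_two) (hc2.trans (by linarith)) hc (by positivity)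
      _ = π ^ 2 * η ^ 2 := by rw [mul_pow, sq_abs]; ring
  calc |Real.cos bp - Real.cos (2 * a - bm) + 2 * Real.cos a * (Real.cos (a - bm) - 1)|
      ≤ |Real.cos bp - Real.cos (2 * a - bm)| + |2 * Real.cos a * (Real.cos (a - bm) - 1)| := abs_add_le _ _
    _ ≤ π ^ 2 * η ^ 2 + π ^ 2 * η ^ 2 := add_le_add h1 h2
    _ = 2 * π ^ 2 * η ^ 2 := by ring

/-- The right-end case `1 − η < t ≤ 1`. [folklore] -/
theorem abs_thetaP_second_diff_le_right {t η : ℝ} (hη : 0 ≤ η) (hη1 : η ≤ 1) (ht1 : t ≤ 1) (ht : 1 - η < t) :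
    |thetaP (t + η) - 2 * thetaP t + thetaP (t - η)| ≤ 12 * π ^ 2 * η ^ 2 := by
  rw [thetaP_eq_zero_of_one_le_abs (by rw [abs_of_nonneg (by linarith)]; linarith), zero_sub]
  have e0 : thetaP t = thetaP (1 - (1 - t)) := by ring_nf
  have e1 : thetaP (t - η) = thetaP (1 - (1 - t + η)) := by ring_nf
  have b0 := thetaP_one_sub_le (u := 1 - t) (by linarith) (by linarith)
  have b1 := thetaP_one_sub_le (u := 1 - t + η) (by linarith) (by linarith)
  have p0 := thetaP_nonneg t
  have p1 := thetaP_nonneg (t - η)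
  rw [← e0] at b0; rw [← e1] at b1
  have hu0 : (1 - t) ^ 2 ≤ η ^ 2 := by nlinarith
  have hu1 : (1 - t + η) ^ 2 ≤ 4 * η ^ 2 := by nlinarith
  rw [abs_le]; constructor <;> nlinarith [Real.pi_pos, sq_nonneg π]

/-- The far-right case `1 < t`. [folklore] -/
theorem abs_thetaP_second_diff_le_far {t η : ℝ} (hη : 0 ≤ η) (hη1 : η ≤ 1) (ht : 1 < t) :
    |thetaP (t + η) - 2 * thetaP t + thetaP (t - η)| ≤ 12 * π ^ 2 * η ^ 2 := by
  rw [thetaP_eq_zero_of_one_le_abs (by rw [abs_of_nonneg (by linarith)]; linarith), thetaP_eq_zero_of_one_le_abs (by rw [abs_of_nonneg (by linarith)]; exact ht.le),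
    mul_zero, sub_zero, zero_add]
  by_cases h : 1 < t - η
  · rw [thetaP_eq_zero_of_one_le_abs (by rw [abs_of_nonneg (by linarith)]; exact h.le), abs_zero]; positivity
  · push Not at h
    have e1 : thetaP (t - η) = thetaP (1 - (1 - t + η)) := by ring_nf
    have b1 := thetaP_one_sub_le (u := 1 - t + η) (by linarith) (by linarith)
    rw [← e1] at b1
    rw [abs_of_nonneg (thetaP_nonneg _)]
    have hu1 : (1 - t + η) ^ 2 ≤ η ^ 2 := by nlinarith
    nlinarith [Real.pi_pos, sq_nonneg π]

/-- ★★★ **THE SECOND-DIFFERENCE LETTER** `|Θ(t+η) − 2Θ(t) + Θ(t−η)| ≤ 12π²η²` for `0 ≤ η ≤ 1` (⟹ `|∇*∇h_□| ≤ 12π²∕M²`). [cite: Balaban1984PropagatorsII, (2.36) p.229 («|∂²h_□| ≤ O(1)M⁻²»: shape)] -/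
theorem abs_thetaP_second_diff_le {t η : ℝ} (hη : 0 ≤ η) (hη1 : η ≤ 1) : |thetaP (t + η) - 2 * thetaP t + thetaP (t - η)| ≤ 12 * π ^ 2 * η ^ 2 := by
  have hsymm : ∀ t : ℝ, thetaP (-t + η) - 2 * thetaP (-t) + thetaP (-t - η) = thetaP (t - η) - 2 * thetaP t + thetaP (t + η) := by
    intro t; rw [show -t + η = -(t - η) by ring, show -t - η = -(t + η) by ring, thetaP_neg, thetaP_neg, thetaP_neg]
  by_cases h1 : 1 < t
  · exact abs_thetaP_second_diff_le_far hη hη1 h1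
  by_cases h2 : 1 - η < t
  · exact abs_thetaP_second_diff_le_right hη hη1 (not_lt.1 h1) h2
  by_cases h3 : -1 + η ≤ t
  · push Not at h1 h2
    exact (abs_thetaP_second_diff_le_of_abs_le (abs_le.2 ⟨by linarith, by linarith⟩) (abs_le.2 ⟨by linarith, by linarith⟩) (abs_le.2 ⟨by linarith, by linarith⟩)).trans
      (by nlinarith [Real.pi_pos, sq_nonneg π, sq_nonneg η])
  by_cases h4 : -1 ≤ t
  · push Not at h3
    have key := abs_thetaP_second_diff_le_right (t := -t) hη hη1 (by linarith) (by linarith)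
    rw [hsymm] at key
    rwa [show thetaP (t + η) - 2 * thetaP t + thetaP (t - η) = thetaP (t - η) - 2 * thetaP t + thetaP (t + η) by ring]
  · push Not at h4
    have key := abs_thetaP_second_diff_le_far (t := -t) hη hη1 (by linarith)
    rw [hsymm] at key
    rwa [show thetaP (t + η) - 2 * thetaP t + thetaP (t - η) = thetaP (t - η) - 2 * thetaP t + thetaP (t + η) by ring]

end Summit.QuantumFields.YangMills.BalabanUVNodes.N15.Gluing

end
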